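import Summits.HubbardSuperconductivity.HubbardLadder.Bounds.KinWeightCeilingTPrime
import Summits.HubbardSuperconductivity.HubbardLadder.Bounds.StiffnessCeilings
import Literature.MathematicalPhysics.QuantumLattice.HubbardNNNHoppingFluxStiffness
import HarnessLib

/-!
# The explicit superfluid-stiffness bound for the `t–t'` Hubbard class (typed AND proved)

HONEST FRAMING: ladder R1–R4 with certified numbers; no claim on H/H₀. Bounds for a MODEL CLASS
(the `t–t'` Hubbard torus `hubbardTorusTT' L 1 t' U` on `(ℤ/L)²`, every `t'`, `U`, filling), no
materials claim.

`HalfBathtubStiffnessBoundTT'` is bounds.tex Thm 1(b)+(c) / Cor. 2.2(iii) for the `t–t'` band made a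
Lean statement and PROVED: if the flux envelope of the twisted `t–t'` torus
(`fluxEnergyTT' L t' U δ θ`, Literature `HubbardNNNHoppingFlux.lean`: every bond crossing the seam,
nearest-neighbour or diagonal, carries `e^{±iθ}`) is stiff, `E(θ) − E(0) ≥ ρ_s θ²` for `|θ| ≤ θ₀`,
then for every `ν`

  `ρ_s L² ≤ ν N_L / 2 + Σ_k (cos k₁ + cos k₂ + 4 t' cos k₁ cos k₂ − ν)⁺`,

i.e. `ρ_s ≤ s_L(n, t')/2` with `s_L` the certified half-bathtub column of EXTREMISERS.md §2
(Hazra–Verma–Randeria 2019 eq. (3), `k_B T_c ≤ π D_s/2 ≤ π D̃/8`, at `T = 0`, with the sharp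
one-body constant in place of HVR's `2ñ` step estimate, for the band `ε_k = −2(cos k₁ + cos k₂) −
4t' cos k₁ cos k₂`). PROOF = Literature f-sum floor for the `t–t'` torus
(`stiffnessTT'_mul_sq_le_kinetic_of_isGroundStateInSector`: `ρ_s L² ≤ K_x(ψ) + t' K_d(ψ)` at any
zero-flux sector ground state, uniform gauge + `±θ` average) ∘ the landed rotation-averaged ceiling
`groundStateKinWeightCeilingTT'_holds` (`K_x + t' K_diag ≤ ν N_L/2 + Σ_k (…)⁺` at a suitable unit
ground state). At `t' = 0` it is the landed `HalfBathtubStiffnessBound`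
(`halfBathtubStiffnessBound_of_TT'`).

References: HazraVermaRanderia2019 eqs. (2)–(6); ScalapinoWhiteZhang1993 §II;
ParamekantiTrivediRanderia1998 eq. (3); XuEtAl2024 eq. (1); Watanabe2019 §2.2.3, §4.1.
-/

noncomputable section

namespace Summit.HubbardSuperconductivity.HubbardLadder.Bounds

open Matrix Finset Real
open Literature.MathematicalPhysics.QuantumLattice
open Literature.MathematicalPhysics.QuantumFieldTheory
open Literature.Probability.LatticeModels
open scoped ComplexConjugate

/-- **The explicit stiffness bound for the `t–t'` class** (bounds.tex Thm 1(b)+(c) with `t'`;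
Hazra–Verma–Randeria 2019 eq. (3) at `T = 0` with the sharp half-bathtub constant): for `L ≥ 3`,
every `t'`, `U`, `δ ≥ -1`, a flux stiffness `ρ_s` of the twisted `t–t'` torus in the sector
`(N_L, S^z = 0)` satisfies `ρ_s L² ≤ ν N_L/2 + Σ_k (cos k₁ + cos k₂ + 4t' cos k₁ cos k₂ − ν)⁺` for
every `ν`. PROVED below (`halfBathtubStiffnessBoundTT'_holds`). -/
@[conjecture] def HalfBathtubStiffnessBoundTT' : Prop :=
  ∀ (L : ℕ) [NeZero L], 3 ≤ L → ∀ (t' U δ ρs θ₀ : ℝ), -1 ≤ δ → 0 < ρs → 0 < θ₀ →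
    (∀ θ : ℝ, |θ| ≤ θ₀ → ρs * θ ^ 2 ≤ fluxEnergyTT' L t' U δ θ - fluxEnergyTT' L t' U δ 0) →
    ∀ ν : ℝ, ρs * (L : ℝ) ^ 2 ≤
      ν * ((2 * ⌊(1 - δ) * (L : ℝ) ^ 2 / 2⌋₊ : ℕ) : ℝ) / 2 +
        ∑ k : TorusSite 2 L,
          max (Real.cos (latticeMomentum L k 0) + Real.cos (latticeMomentum L k 1) +
            4 * t' * (Real.cos (latticeMomentum L k 0) * Real.cos (latticeMomentum L k 1)) - ν) 0

/-- The diagonal kinetic weight of the Literature floor is the tree's `kinWeightDiag`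
(`Σ_s K_{j_s} = K_{j_0} + K_{j_1}`). -/
theorem sum_shiftKinWeight_eq_kinWeightDiag {L : ℕ} [NeZero L] (ψ : Fock (Orb (FermionTorus 2 L))) :
    (∑ s : Fin 2, ∑ x : Site 2 L, ∑ σ : Fin 2,
        (star ψ ⬝ᵥ ((creation (orb (FermionTorus.ofTorusSite (x + torusDiagJump L s)) σ) *
          annihilation (orb (FermionTorus.ofTorusSite x) σ)) *ᵥ ψ)).re) = kinWeightDiag ψ := by
  rw [Fin.sum_univ_two]
  rfl

/-- **Composition (PROVED): the `t–t'` ceiling implies the explicit `t–t'` stiffness bound**, via the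
Literature f-sum floor for the twisted `t–t'` torus applied to the ground state the ceiling provides. -/
theorem halfBathtubStiffnessBoundTT'_of_ceiling (hC : GroundStateKinWeightCeilingTT') :
    HalfBathtubStiffnessBoundTT' := by
  intro L _ hL t' U δ ρs θ₀ hδ hρs hθ₀ hst ν
  obtain ⟨ψ, hgs, h1, hK⟩ := hC L hL t' U δ hδ
  have hfloor := stiffnessTT'_mul_sq_le_kinetic_of_isGroundStateInSector hL t' U δ hρs hθ₀ hst hgs h1
  rw [sum_shiftKinWeight_eq_kinWeightDiag] at hfloor
  exact hfloor.trans (hK ν)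

/-- **`HalfBathtubStiffnessBoundTT'` holds** (ceiling `groundStateKinWeightCeilingTT'_holds` ∘ floor). -/
theorem halfBathtubStiffnessBoundTT'_holds : HalfBathtubStiffnessBoundTT' :=
  halfBathtubStiffnessBoundTT'_of_ceiling groundStateKinWeightCeilingTT'_holds

/-- **Consistency at `t' = 0`**: the `t–t'` bound specialises to the landed nearest-neighbour bound
`HalfBathtubStiffnessBound` (`fluxEnergyTT' L 0 = fluxEnergy L`, the `t'`-term of the symbol drops). -/
theorem halfBathtubStiffnessBound_of_TT' (h : HalfBathtubStiffnessBoundTT') : HalfBathtubStiffnessBound := by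
  intro L _ hL U δ ρs θ₀ hδ hρs hθ₀ hst ν
  have h0 := h L hL 0 U δ ρs θ₀ hδ hρs hθ₀ (by simpa only [fluxEnergyTT'_tPrime_zero] using hst) ν
  simpa only [zero_mul, mul_zero, add_zero] using h0

end Summit.HubbardSuperconductivity.HubbardLadder.Bounds
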